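import Summits.Ventures.PercRepro.PuncturedLYMAvoidInstB_1
import Summits.Ventures.PercRepro.PuncturedLYMAvoidInstB_2
import Summits.Ventures.PercRepro.PuncturedLYMAvoidInstB_3
import Summits.Ventures.PercRepro.PuncturedLYMAvoidInstB_4
import Summits.Ventures.PercRepro.PuncturedLYMAvoidInstB_5
import Summits.Ventures.PercRepro.PuncturedLYMAvoidInstB_6
import Summits.Ventures.PercRepro.PuncturedLYMAvoidInstB_7
import Summits.Ventures.PercRepro.PuncturedLYMAvoidInstB_8
import Summits.Ventures.PercRepro.PuncturedLYMAvoidInstB_9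
import Summits.Ventures.PercRepro.PuncturedLYMAvoidInstB_10
import Summits.Ventures.PercRepro.PuncturedLYMAvoidInstB_11
import Summits.Ventures.PercRepro.PuncturedLYMAvoidInstB_12
import Summits.Ventures.PercRepro.PuncturedLYMAvoidInstB_13
import Summits.Ventures.PercRepro.PuncturedLYMAvoidInstB_14
import Summits.Ventures.PercRepro.PuncturedLYMAvoidInstB_15
import Summits.Ventures.PercRepro.PuncturedLYMAvoidMain

/-!
# PercRepro — (SP) BY SUPERPOSITION, PART 14d: THEOREM F EXTENDED TO `j ≤ 30` — (SP) FOR EVERY CODE WITH `j ≤ 30` AND `2j + 1 ≤ n`; (NC) FOR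
EVERY SPARSE PAVING MATROID OF CORANK `≤ 30` (p10, gen 32)

With the point-avoiding certificate instances (PuncturedLYMAvoidInst_*) on every `(n, j)` with `25 ≤ j ≤ 30`,
`2j + 1 ≤ n ≤ 3j − 3`, Theorem A sharp above `3j − 2` and `puncturedNMP_of_le_twentyfour` below `j = 25`:
* **`puncturedNMP_of_le_thirty`** — (SP) for every code with `1 ≤ j ≤ 30` and `2j + 1 ≤ n`;
* `puncturedNMP_in_of_le_thirty` — the same inside any finset;
* **`normConsAt_of_sparsePaving_corank_le_thirty`** — (NC) for every sparse paving matroid of corank `n − r ≤ 30` with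
  `r + 1 ≤ n ≤ 2r − 2`, on any ground set.
The pairs `(n, j)` with `j ≥ 31` and `2j + 1 ≤ n ≤ 3j − 3` are NOT covered here (the same bound is below `1` on every
pair tested up to `j = 200`; only the instances are missing).  Nothing here asserts (SP) in general.
-/

open scoped Matroid

namespace PercRepro.PuncturedLYM

open Finset

variable {α : Type} [Fintype α] [DecidableEq α]

/-- **THEOREM F (extended): (SP) holds for every code with `1 ≤ j ≤ 30` and `2j + 1 ≤ n`.** -/
theorem puncturedNMP_of_le_thirty {j : ℕ} {D : Finset (Finset α)} (hD : IsCode j D) (hj1 : 1 ≤ j) (hj : j ≤ 30)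
    (hn : 2 * j + 1 ≤ Fintype.card α) : PuncturedNMP j D := by
  rcases Nat.lt_or_ge j 25 with hjlt | hjge
  · exact puncturedNMP_of_le_twentyfour hD hj1 (by omega) hn
  rcases Nat.lt_or_ge (Fintype.card α + 2) (3 * j) with hlt | hge
  · obtain ⟨n, hcard⟩ : ∃ n, Fintype.card α = n := ⟨_, rfl⟩
    rw [hcard] at hlt hn
    interval_cases j
    · have hub : n ≤ 72 := by omega
      interval_cases n
      · exact inst3_51_25 hcard hD
      · exact inst3_52_25 hcard hD
      · exact inst3_53_25 hcard hD
      · exact inst3_54_25 hcard hD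
      · exact inst3_55_25 hcard hD
      · exact inst3_56_25 hcard hD
      · exact inst3_57_25 hcard hD
      · exact inst3_58_25 hcard hD
      · exact inst3_59_25 hcard hD
      · exact inst3_60_25 hcard hD
      · exact inst3_61_25 hcard hD
      · exact inst3_62_25 hcard hD
      · exact inst3_63_25 hcard hD
      · exact inst3_64_25 hcard hD
      · exact inst3_65_25 hcard hD
      · exact inst3_66_25 hcard hD
      · exact inst3_67_25 hcard hD
      · exact inst3_68_25 hcard hD
      · exact inst3_69_25 hcard hD
      · exact inst3_70_25 hcard hD
      · exact inst3_71_25 hcard hD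
      · exact inst3_72_25 hcard hD
    · have hub : n ≤ 75 := by omega
      interval_cases n
      · exact inst3_53_26 hcard hD
      · exact inst3_54_26 hcard hD
      · exact inst3_55_26 hcard hD
      · exact inst3_56_26 hcard hD
      · exact inst3_57_26 hcard hD
      · exact inst3_58_26 hcard hD
      · exact inst3_59_26 hcard hD
      · exact inst3_60_26 hcard hD
      · exact inst3_61_26 hcard hD
      · exact inst3_62_26 hcard hD
      · exact inst3_63_26 hcard hD
      · exact inst3_64_26 hcard hD
      · exact inst3_65_26 hcard hD
      · exact inst3_66_26 hcard hD
      · exact inst3_67_26 hcard hD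
      · exact inst3_68_26 hcard hD
      · exact inst3_69_26 hcard hD
      · exact inst3_70_26 hcard hD
      · exact inst3_71_26 hcard hD
      · exact inst3_72_26 hcard hD
      · exact inst3_73_26 hcard hD
      · exact inst3_74_26 hcard hD
      · exact inst3_75_26 hcard hD
    · have hub : n ≤ 78 := by omega
      interval_cases n
      · exact inst3_55_27 hcard hD
      · exact inst3_56_27 hcard hD
      · exact inst3_57_27 hcard hD
      · exact inst3_58_27 hcard hD
      · exact inst3_59_27 hcard hD
      · exact inst3_60_27 hcard hD
      · exact inst3_61_27 hcard hD
      · exact inst3_62_27 hcard hD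
      · exact inst3_63_27 hcard hD
      · exact inst3_64_27 hcard hD
      · exact inst3_65_27 hcard hD
      · exact inst3_66_27 hcard hD
      · exact inst3_67_27 hcard hD
      · exact inst3_68_27 hcard hD
      · exact inst3_69_27 hcard hD
      · exact inst3_70_27 hcard hD
      · exact inst3_71_27 hcard hD
      · exact inst3_72_27 hcard hD
      · exact inst3_73_27 hcard hD
      · exact inst3_74_27 hcard hD
      · exact inst3_75_27 hcard hD
      · exact inst3_76_27 hcard hD
      · exact inst3_77_27 hcard hD
      · exact inst3_78_27 hcard hD
    · have hub : n ≤ 81 := by omega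
      interval_cases n
      · exact inst3_57_28 hcard hD
      · exact inst3_58_28 hcard hD
      · exact inst3_59_28 hcard hD
      · exact inst3_60_28 hcard hD
      · exact inst3_61_28 hcard hD
      · exact inst3_62_28 hcard hD
      · exact inst3_63_28 hcard hD
      · exact inst3_64_28 hcard hD
      · exact inst3_65_28 hcard hD
      · exact inst3_66_28 hcard hD
      · exact inst3_67_28 hcard hD
      · exact inst3_68_28 hcard hD
      · exact inst3_69_28 hcard hD
      · exact inst3_70_28 hcard hD
      · exact inst3_71_28 hcard hD
      · exact inst3_72_28 hcard hD
      · exact inst3_73_28 hcard hD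
      · exact inst3_74_28 hcard hD
      · exact inst3_75_28 hcard hD
      · exact inst3_76_28 hcard hD
      · exact inst3_77_28 hcard hD
      · exact inst3_78_28 hcard hD
      · exact inst3_79_28 hcard hD
      · exact inst3_80_28 hcard hD
      · exact inst3_81_28 hcard hD
    · have hub : n ≤ 84 := by omega
      interval_cases n
      · exact inst3_59_29 hcard hD
      · exact inst3_60_29 hcard hD
      · exact inst3_61_29 hcard hD
      · exact inst3_62_29 hcard hD
      · exact inst3_63_29 hcard hD
      · exact inst3_64_29 hcard hD
      · exact inst3_65_29 hcard hD
      · exact inst3_66_29 hcard hD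
      · exact inst3_67_29 hcard hD
      · exact inst3_68_29 hcard hD
      · exact inst3_69_29 hcard hD
      · exact inst3_70_29 hcard hD
      · exact inst3_71_29 hcard hD
      · exact inst3_72_29 hcard hD
      · exact inst3_73_29 hcard hD
      · exact inst3_74_29 hcard hD
      · exact inst3_75_29 hcard hD
      · exact inst3_76_29 hcard hD
      · exact inst3_77_29 hcard hD
      · exact inst3_78_29 hcard hD
      · exact inst3_79_29 hcard hD
      · exact inst3_80_29 hcard hD
      · exact inst3_81_29 hcard hD
      · exact inst3_82_29 hcard hD
      · exact inst3_83_29 hcard hD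
      · exact inst3_84_29 hcard hD
    · have hub : n ≤ 87 := by omega
      interval_cases n
      · exact inst3_61_30 hcard hD
      · exact inst3_62_30 hcard hD
      · exact inst3_63_30 hcard hD
      · exact inst3_64_30 hcard hD
      · exact inst3_65_30 hcard hD
      · exact inst3_66_30 hcard hD
      · exact inst3_67_30 hcard hD
      · exact inst3_68_30 hcard hD
      · exact inst3_69_30 hcard hD
      · exact inst3_70_30 hcard hD
      · exact inst3_71_30 hcard hD
      · exact inst3_72_30 hcard hD
      · exact inst3_73_30 hcard hD
      · exact inst3_74_30 hcard hD
      · exact inst3_75_30 hcard hD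
      · exact inst3_76_30 hcard hD
      · exact inst3_77_30 hcard hD
      · exact inst3_78_30 hcard hD
      · exact inst3_79_30 hcard hD
      · exact inst3_80_30 hcard hD
      · exact inst3_81_30 hcard hD
      · exact inst3_82_30 hcard hD
      · exact inst3_83_30 hcard hD
      · exact inst3_84_30 hcard hD
      · exact inst3_85_30 hcard hD
      · exact inst3_86_30 hcard hD
      · exact inst3_87_30 hcard hD
  · exact puncturedNMP_of_three_j' hD (by omega) hn hge

omit [Fintype α] in
/-- (SP) inside any finset `E` for `1 ≤ j ≤ 30`, `2j + 1 ≤ #E`. -/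
theorem puncturedNMP_in_of_le_thirty {E : Finset α} {j : ℕ} {D : Finset (Finset α)} (hD : IsCodeIn j E D)
    (hj1 : 1 ≤ j) (hj : j ≤ 30) (hn : 2 * j + 1 ≤ E.card) : PuncturedNMPIn j E D := by
  apply puncturedNMP_in_of_subtype hD
  apply puncturedNMP_of_le_thirty (isCode_image_toSub hD) hj1 hj
  rw [Fintype.card_coe]
  exact hn

end PercRepro.PuncturedLYM

namespace PercRepro.Cogirth

open Finset ThmH Skew

variable {α : Type} [DecidableEq α] {M : Matroid α} [M.Finite]

/-- **(NC) for every sparse paving matroid of corank `n − r ≤ 30`** with `r + 1 ≤ n` and `n + 2 ≤ 2r`. -/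
theorem normConsAt_of_sparsePaving_corank_le_thirty {r : ℕ} (hsp : IsSparsePavingF M r) (hr1 : r + 1 ≤ (gr M).card)
    (hn : (gr M).card + 2 ≤ 2 * r) (hJ : (gr M).card - r ≤ 30) : NormConsAt M := by
  intro U hU j
  have hr : r ≤ (gr M).card := by omega
  rcases Nat.lt_or_ge j ((gr M).card - r) with hlt | hge
  · apply normConsStep_of_lt
    rw [hsp.1]
    omega
  rcases Nat.eq_or_lt_of_le hge with heq | hgt
  · rw [← heq]
    apply normConsStep_bottom_of_puncturedNMPIn hsp hn hU
    exact PuncturedLYM.puncturedNMP_in_of_le_thirty (isCodeIn_cocode hsp hr) (by omega) hJ (by omega)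
  rcases Nat.lt_or_ge (j + 1) r with hmid | htop
  · apply normConsStep_of_indep_succ_of_indep_sdiff hU (by omega)
    · intro S hS hSc
      exact rk_eq_card_of_card_lt_of_sparsePaving hsp hr hS (by omega)
    · intro S hS hSc
      exact rk_eq_card_of_card_lt_of_sparsePaving hsp hr hS (by omega)
  · apply normConsStep_of_rk_le hU
    rw [hsp.1]
    omega

end PercRepro.Cogirth
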